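import Mathlib
import Summits.Ventures.PercRepro.PuncturedLYMTypeLift

/-!
# PercRepro — THE TYPE LIFT AT THE PUNCTURED LEVEL OF A PAIRWISE DISJOINT FAMILY
(p10, gen 39)

The punctured level of a family `C i` (`i : Fin k`) is `punctured j (⋃_i upLevel j (C i))`: the `j`-sets containing
no member (`mem_punctured_family`).  For pairwise disjoint members with `#(C i) + #(C l) ≥ j + 2` (no column
contains two members) the column sums of a lifted weight are computed from the type data:

* `colSum_eq_of_free` — at a column `Y` containing no member:
  `Σ_i typ C Y i · W (typ C Y − e_i) (fc C Y) (some i) + fc C Y · W (typ C Y) (fc C Y − 1) none`;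
* `colSum_eq_of_member` — at a column `Y ⊇ C i₀`: `#(C i₀) · W (typ C Y − e_{i₀}) (fc C Y) (some i₀)`;
* `sum_typ_add_fc`, `typ_lt_card_of_not_subset`, `fc_le_card`, `card_freeSet` — the constraints a row type
  satisfies, which make the certificate finite.
Nothing here asserts (SP).
-/

namespace PercRepro.PuncturedLYM.Split.TypeLift

open Finset

variable {α : Type} [DecidableEq α] [Fintype α] {k : ℕ}

/-! ### The punctured level of a family and the column sums -/

/-- The rows punctured by the family: the `j`-sets containing no member. -/
theorem mem_punctured_family {j : ℕ} {C : Fin k → Finset α} {X : Finset α} :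
    X ∈ punctured j ((univ : Finset (Fin k)).biUnion (fun i => upLevel j (C i))) ↔
      X.card = j ∧ ∀ i, ¬ C i ⊆ X := by
  unfold punctured
  simp only [mem_sdiff, mem_powersetCard, subset_univ, true_and, mem_biUnion, mem_univ, mem_upLevel,
    not_exists, not_and]
  constructor
  · rintro ⟨hX, h⟩
    exact ⟨hX, fun i hi => h i hX hi⟩
  · rintro ⟨hX, h⟩
    exact ⟨hX, fun i _ hi => h i hi⟩

/-- A row of the punctured level is a `j`-set. -/
theorem card_eq_of_mem_punctured_family {j : ℕ} {C : Fin k → Finset α} {X : Finset α}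
    (hX : X ∈ punctured j ((univ : Finset (Fin k)).biUnion (fun i => upLevel j (C i)))) : X.card = j :=
  (mem_punctured_family.1 hX).1

/-- At a column containing no member every `Y.erase y` is a row. -/
theorem filter_erase_eq_of_free {j : ℕ} {C : Fin k → Finset α} {Y : Finset α} (hY : Y.card = j + 1)
    (hfree : ∀ i, ¬ C i ⊆ Y) :
    Y.filter (fun y => Y.erase y ∈ punctured j ((univ : Finset (Fin k)).biUnion (fun i => upLevel j (C i)))) = Y := by
  apply filter_true_of_mem
  intro y hy
  rw [mem_punctured_family]
  refine ⟨by rw [card_erase_of_mem hy, hY]; rfl, fun i hi => hfree i (hi.trans (erase_subset y Y))⟩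

/-- At a column containing the member `C i₀` the rows are the `Y.erase y`, `y ∈ C i₀` (pairwise disjoint members,
no second member fits: `#(C i₀) + #(C l) ≥ j + 2`). -/
theorem filter_erase_eq_of_member {j : ℕ} {C : Fin k → Finset α} (hdisj : ∀ i l, i ≠ l → Disjoint (C i) (C l))
    (hbig : ∀ i l, i ≠ l → j + 2 ≤ (C i).card + (C l).card) {Y : Finset α} (hY : Y.card = j + 1) {i₀ : Fin k}
    (hmem : C i₀ ⊆ Y) :
    Y.filter (fun y => Y.erase y ∈ punctured j ((univ : Finset (Fin k)).biUnion (fun i => upLevel j (C i)))) =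
      C i₀ := by
  ext y
  rw [mem_filter, mem_punctured_family]
  constructor
  · rintro ⟨hyY, _, h⟩
    by_contra hy
    apply h i₀
    intro z hz
    rw [mem_erase]
    exact ⟨fun hzy => hy (hzy ▸ hz), hmem hz⟩
  · intro hy
    have hyY : y ∈ Y := hmem hy
    refine ⟨hyY, by rw [card_erase_of_mem hyY, hY]; rfl, fun l hl => ?_⟩
    by_cases hli : l = i₀
    · subst hli
      exact (mem_erase.1 (hl hy)).1 rfl
    · -- `C l` is disjoint from `C i₀ ⊆ Y` and too big for the rest of `Y`
      have h1 : (C l ∪ C i₀).card ≤ Y.card := card_le_card (union_subset (hl.trans (erase_subset y Y)) hmem)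
      rw [card_union_of_disjoint (hdisj l i₀ hli), hY] at h1
      have h2 := hbig l i₀ hli
      omega

/-- The column sum at a column containing no member, in the type data. -/
theorem colSum_eq_of_free (W : (Fin k → ℕ) → ℕ → Option (Fin k) → ℚ) {C : Fin k → Finset α}
    (hdisj : ∀ i l, i ≠ l → Disjoint (C i) (C l)) {j : ℕ} {Y : Finset α} (hY : Y.card = j + 1)
    (hfree : ∀ i, ¬ C i ⊆ Y) :
    colSum W C (punctured j ((univ : Finset (Fin k)).biUnion (fun i => upLevel j (C i)))) Y =
      ∑ i, ((typ C Y i : ℕ) : ℚ) * W (Function.update (typ C Y) i (typ C Y i - 1)) (fc C Y) (some i) +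
        ((fc C Y : ℕ) : ℚ) * W (typ C Y) (fc C Y - 1) none := by
  unfold colSum
  rw [filter_erase_eq_of_free hY hfree]
  -- split the points of `Y` by direction
  have hsplit : ∀ y ∈ Y, dirW W C (Y.erase y) y =
      (∑ i, if y ∈ C i then W (Function.update (typ C Y) i (typ C Y i - 1)) (fc C Y) (some i) else 0) +
        (if y ∈ freeSet C then W (typ C Y) (fc C Y - 1) none else 0) := by
    intro y hy
    unfold dirW
    congr 1
    · refine sum_congr rfl (fun i _ => ?_)
      split_ifs with hyi
      · rw [typ_erase_of_mem hdisj hy hyi, fc_erase_of_mem C Y hyi]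
      · rfl
    · split_ifs with hyf
      · rw [typ_erase_of_free C Y hyf, fc_erase_of_free C hy hyf]
      · rfl
  rw [sum_congr rfl hsplit, sum_add_distrib, sum_comm]
  congr 1
  · refine sum_congr rfl (fun i _ => ?_)
    have h : Y.filter (fun y => y ∈ C i) = Y ∩ C i := by
      ext z; simp [mem_filter, mem_inter]
    rw [← sum_filter, sum_const, nsmul_eq_mul, h]
    rfl
  · have h : Y.filter (fun y => y ∈ freeSet C) = Y ∩ freeSet C := by
      ext z; simp [mem_filter, mem_inter]
    rw [← sum_filter, sum_const, nsmul_eq_mul, h]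
    rfl

/-- The column sum at a column containing the member `C i₀`, in the type data. -/
theorem colSum_eq_of_member (W : (Fin k → ℕ) → ℕ → Option (Fin k) → ℚ) {C : Fin k → Finset α}
    (hdisj : ∀ i l, i ≠ l → Disjoint (C i) (C l)) {j : ℕ}
    (hbig : ∀ i l, i ≠ l → j + 2 ≤ (C i).card + (C l).card) {Y : Finset α} (hY : Y.card = j + 1) {i₀ : Fin k}
    (hmem : C i₀ ⊆ Y) :
    colSum W C (punctured j ((univ : Finset (Fin k)).biUnion (fun i => upLevel j (C i)))) Y =
      ((C i₀).card : ℚ) * W (Function.update (typ C Y) i₀ (typ C Y i₀ - 1)) (fc C Y) (some i₀) := by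
  unfold colSum
  rw [filter_erase_eq_of_member hdisj hbig hY hmem]
  rw [sum_congr rfl (fun y hy => dirW_of_mem W hdisj (Y.erase y) hy)]
  rw [sum_congr rfl (fun y hy => by rw [typ_erase_of_mem hdisj (hmem hy) hy, fc_erase_of_mem C Y hy])]
  rw [sum_const, nsmul_eq_mul]

omit [Fintype α] in
/-- At a column containing `C i₀` the `i₀`-coordinate of the type is `#(C i₀)`. -/
theorem typ_eq_card_of_subset (C : Fin k → Finset α) {Y : Finset α} {i₀ : Fin k} (hmem : C i₀ ⊆ Y) :
    typ C Y i₀ = (C i₀).card := by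
  unfold typ
  rw [inter_eq_right.2 hmem]


/-! ### The type constraints of a row -/

/-- The type coordinates and the free count of a set add up to its size (pairwise disjoint members). -/
theorem sum_typ_add_fc {C : Fin k → Finset α} (hdisj : ∀ i l, i ≠ l → Disjoint (C i) (C l)) (X : Finset α) :
    ∑ i, typ C X i + fc C X = X.card := by
  unfold typ fc freeSet
  have h1 : (X ∩ (univ : Finset (Fin k)).biUnion C).card = ∑ i, (X ∩ C i).card := by
    rw [inter_biUnion, card_biUnion]
    intro i _ l _ hil
    exact disjoint_of_subset_left inter_subset_right (disjoint_of_subset_right inter_subset_right (hdisj i l hil))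
  have h2 : X ∩ (univ \ (univ : Finset (Fin k)).biUnion C) = X \ (univ : Finset (Fin k)).biUnion C := by
    ext z; simp [mem_inter, mem_sdiff]
  rw [h2, ← h1, add_comm, card_sdiff_add_card_inter]

omit [Fintype α] in
/-- A row contains no member: every coordinate of its type is below the member's size. -/
theorem typ_lt_card_of_not_subset (C : Fin k → Finset α) {X : Finset α} {i : Fin k} (h : ¬ C i ⊆ X) :
    typ C X i < (C i).card := by
  unfold typ
  apply card_lt_card
  refine ⟨inter_subset_right, fun hsub => h ?_⟩
  intro z hz
  exact (mem_inter.1 (hsub hz)).1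

/-- The free count is at most the number of free points. -/
theorem fc_le_card (C : Fin k → Finset α) (X : Finset α) : fc C X ≤ (freeSet C).card :=
  card_le_card inter_subset_right

/-- The number of free points: `n − Σ #(C i)` (pairwise disjoint members). -/
theorem card_freeSet {C : Fin k → Finset α} (hdisj : ∀ i l, i ≠ l → Disjoint (C i) (C l)) :
    (freeSet C).card = Fintype.card α - ∑ i, (C i).card := by
  unfold freeSet
  rw [card_sdiff_of_subset (subset_univ _), card_univ, card_biUnion]
  intro i _ l _ hil
  exact hdisj i l hil

end PercRepro.PuncturedLYM.Split.TypeLift
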